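import Literature.Computability.Complexity.LupanovBound
import Literature.Computability.Complexity.CircuitClassesProofs
import Literature.InformationTheory.Coding.BCHExplicit
import HarnessLib

/-!
# `GF(2)`-linear and `GF(2)`-affine maps as XOR circuits; coordinates of `GF(2^{M+1})`

Toolkit for the worst-case-to-average-case reduction of `WorstCaseToMild.lean` (Arora–Barak 2009,
Thm. 19.21 / Babai–Fortnow–Nisan–Wigderson 1993: self-correction of the low-degree extension over a
field of characteristic `2`), where every piece of field arithmetic the corrector performs —
`x + t_a y` for fixed nodes `t_a`, the Lagrange combination `Σ λ_a v_a` with fixed weights — is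
`GF(2)`-LINEAR in the bit coordinates and hence an XOR circuit (Vollmer 1999, §1.2: parity has
linear-size `B₂`-circuits):

* `bitZ`/`zBit` — `Bool ↔ ZMod 2`; `bitZ_parityFin` — the XOR chain `parityFin` (`LupanovBound.lean`)
  sums in `ZMod 2`;
* `cktSize_linearForm`, `cktSize_linearForm'`, `cktSize_linearMap`, `cktSize_xorConst`,
  `cktSize_affineMap` — a linear form costs `≤ |ι| + 1` gates, a linear map into `κ` outputs
  `≤ |κ| (|ι| + 1)`, an affine map `≤ |κ| (|ι| + 2)`;
* `encF M`/`decF M` — the coordinates of `GF2 M = 𝔽₂[X]/(f_M)` (`InformationTheory/Coding/BCHExplicit.lean`)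
  in its power basis and back (`decF_encF`, `encF_decF`, `encF_injective`), `encF_add`,
  `encF_linearMap` (coordinates of a `GF(2)`-linear image are a matrix product; multiplication by a
  constant is Mathlib's `LinearMap.mulLeft`).

## References

* H. Vollmer, *Introduction to Circuit Complexity*, Springer 1999, §1.2 [Vollmer1999].
* R. J. McEliece, *The Theory of Information and Coding*, 2nd ed., CUP 2002, Ch. 9 §9.1 (field
  elements as coefficient tuples) [Mceliece2002].
-/

noncomputable section

namespace Literature.Computability.Complexity

open Finset

/-! ### Bits and `ZMod 2` -/

/-- A bit as an element of `ZMod 2`: Mathlib's `finTwoEquiv.symm` (`ZMod 2` is `Fin 2`). Tree copies of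
this map to be deduplicated onto `finTwoEquiv` by a librarian pass: `GateEliminationAffineGates.boolToZMod2`,
`HadamardPCP.toZ`, `StockmeyerEstimator.bz`, `NaturalLearningPredictor.boolToZMod`, `MonotoneDNF.bitZ`. [folklore] -/
abbrev bitZ : Bool → ZMod 2 := finTwoEquiv.symm

/-- An element of `ZMod 2` as a bit: Mathlib's `finTwoEquiv`. [folklore] -/
abbrev zBit : ZMod 2 → Bool := finTwoEquiv

/-- `bitZ 1 = 1`. [folklore] -/
@[simp] theorem bitZ_true : bitZ true = 1 := rfl

/-- `bitZ 0 = 0`. [folklore] -/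
@[simp] theorem bitZ_false : bitZ false = 0 := rfl

/-- `zBit` inverts `bitZ` (`Equiv.apply_symm_apply`). [folklore] -/
@[simp] theorem zBit_bitZ (b : Bool) : zBit (bitZ b) = b := finTwoEquiv.apply_symm_apply b

/-- `bitZ` inverts `zBit` (`Equiv.symm_apply_apply`). [folklore] -/
@[simp] theorem bitZ_zBit (a : ZMod 2) : bitZ (zBit a) = a := finTwoEquiv.symm_apply_apply a

/-- `bitZ` of an XOR is the sum. [folklore] -/
theorem bitZ_xor (b c : Bool) : bitZ (xor b c) = bitZ b + bitZ c := by
  cases b <;> cases c <;> decide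

/-- `zBit` of a sum is the XOR. [folklore] -/
theorem zBit_add (a b : ZMod 2) : zBit (a + b) = xor (zBit a) (zBit b) := by
  fin_cases a <;> fin_cases b <;> decide

/-! ### Parities -/

/-- The XOR chain `parityFin` computes the sum in `ZMod 2`. [folklore] -/
theorem bitZ_parityFin : ∀ (M : ℕ) (z : Fin M → Bool), bitZ (parityFin M z) = ∑ j, bitZ (z j)
  | 0, z => by simp [parityFin]
  | M + 1, z => by
    rw [parityFin, bitZ_xor, bitZ_parityFin M, Fin.sum_univ_castSucc]

/-- **A `GF(2)`-linear form is an XOR circuit**: `x ↦ Σᵢ cᵢ xᵢ` (as a bit) costs `≤ a + 1` gates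
over `B₂` (an XOR chain over the support of `c`). [cite: Vollmer1999, §1.2] -/
theorem cktSize_linearForm {a : ℕ} (c : Fin a → ZMod 2) :
    CktSize B2 (fun (x : Fin a → Bool) (_ : Unit) => zBit (∑ i, c i * bitZ (x i))) (a + 1) := by
  classical
  -- the support, enumerated
  set S : Finset (Fin a) := univ.filter fun i => c i = 1 with hS
  set e := S.equivFin with he
  have h := (cktSize_parityFin S.card).rewire (ι' := Fin a) (fun j => (e.symm j : Fin a))
  refine (h.of_le (by have := card_le_univ S; rw [Fintype.card_fin] at this; omega)).congr fun x _ => ?_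
  -- both sides are `zBit` of the same sum
  have hc : ∀ i, c i = 0 ∨ c i = 1 := fun i => by
    generalize c i = t
    fin_cases t
    · exact Or.inl rfl
    · exact Or.inr rfl
  have hsum : ∑ i, c i * bitZ (x i) = ∑ i ∈ S, bitZ (x i) := by
    rw [← Finset.sum_filter_add_sum_filter_not univ (fun i => c i = 1)]
    have h0 : ∑ i ∈ univ.filter (fun i => ¬ c i = 1), c i * bitZ (x i) = 0 :=
      Finset.sum_eq_zero fun i hi => by
        rcases hc i with h | h
        · rw [h, zero_mul]
        · exact absurd h (mem_filter.1 hi).2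
    rw [h0, add_zero, hS]
    exact Finset.sum_congr rfl fun i hi => by rw [(mem_filter.1 hi).2, one_mul]
  rw [hsum, ← zBit_bitZ (parityFin _ _), bitZ_parityFin]
  congr 1
  rw [← Finset.sum_coe_sort S]
  exact Fintype.sum_equiv e.symm _ _ fun j => rfl

/-- A `GF(2)`-linear form on any finite index type is an XOR circuit of size `≤ |ι| + 1`.
[cite: Vollmer1999, §1.2] -/
theorem cktSize_linearForm' {ι : Type*} [Fintype ι] (c : ι → ZMod 2) :
    CktSize B2 (fun (x : ι → Bool) (_ : Unit) => zBit (∑ i, c i * bitZ (x i))) (Fintype.card ι + 1) := by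
  classical
  set e := Fintype.equivFin ι
  have h := (cktSize_linearForm (fun j => c (e.symm j))).rewire (ι' := ι) (fun j => e.symm j)
  refine h.congr fun x _ => ?_
  congr 1
  exact Fintype.sum_equiv e.symm _ _ fun j => rfl

/-- **A `GF(2)`-linear map is an XOR circuit**: `x ↦ (Σᵢ A j i xᵢ)ⱼ` costs `≤ |κ| (|ι| + 1)` gates.
[cite: Vollmer1999, §1.2] -/
theorem cktSize_linearMap {ι κ : Type*} [Fintype ι] [Fintype κ] (A : κ → ι → ZMod 2) :
    CktSize B2 (fun (x : ι → Bool) (j : κ) => zBit (∑ i, A j i * bitZ (x i)))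
      (Fintype.card κ * (Fintype.card ι + 1)) :=
  CktSize.pi_const fun j => cktSize_linearForm' (A j)

/-- Adding a constant bit costs at most one gate. [folklore] -/
theorem cktSize_xorConst {ι : Type*} (i : ι) (b : Bool) :
    CktSize B2 (fun (x : ι → Bool) (_ : Unit) => xor (x i) b) 1 := by
  cases b
  · exact ((CktSize.proj B2 fun _ : Unit => i).of_le (Nat.zero_le 1)).congr fun x _ => by simp
  · exact (cktSize_not i).congr fun x _ => by simp

/-- **A `GF(2)`-affine map is an XOR circuit**: `x ↦ (Σᵢ A j i xᵢ + vⱼ)ⱼ` costs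
`≤ |κ| (|ι| + 2)` gates. [cite: Vollmer1999, §1.2] -/
theorem cktSize_affineMap {ι κ : Type*} [Fintype ι] [Fintype κ] (A : κ → ι → ZMod 2) (v : κ → ZMod 2) :
    CktSize B2 (fun (x : ι → Bool) (j : κ) => zBit (∑ i, A j i * bitZ (x i) + v j))
      (Fintype.card κ * (Fintype.card ι + 2)) := by
  refine CktSize.pi_const fun j => ?_
  have h := (cktSize_linearForm' (A j)).comp (cktSize_xorConst (ι := Unit) () (zBit (v j)))
  refine h.congr fun x _ => ?_
  rw [zBit_add, zBit]

/-! ### Coordinates of `GF(2^{M+1})` -/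

section GF2

open Literature.InformationTheory.Coding

variable (M : ℕ)

/-- **Bit encoding of a field element**: its coordinates in the power basis `1, x, …, x^M` of
`GF(2^{M+1}) = 𝔽₂[X]/(f_M)` (`GF2.basis`, `BCHExplicit.lean`). [cite: Mceliece2002, Ch. 9 §9.1] -/
def encF (u : GF2 M) : Fin (M + 1) → Bool := fun l => zBit ((GF2.basis M).repr u l)

/-- **Decoding a bit vector to a field element.** [folklore] -/
def decF (w : Fin (M + 1) → Bool) : GF2 M := ∑ l, bitZ (w l) • GF2.basis M l

/-- `decF` inverts `encF`. [folklore] -/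
@[simp] theorem decF_encF (u : GF2 M) : decF M (encF M u) = u := by
  unfold decF encF
  simp only [bitZ_zBit]
  exact (GF2.basis M).sum_repr u

/-- `encF` inverts `decF`. [folklore] -/
@[simp] theorem encF_decF (w : Fin (M + 1) → Bool) : encF M (decF M w) = w := by
  funext l
  unfold decF encF
  rw [map_sum]
  simp only [map_smul, Module.Basis.repr_self, Finsupp.coe_finsetSum, Finsupp.coe_smul, Finset.sum_apply,
    Pi.smul_apply, Finsupp.single_apply, smul_eq_mul, mul_ite, mul_one, mul_zero, Finset.sum_ite_eq',
    Finset.mem_univ, if_true, zBit_bitZ]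

/-- `encF` is injective. [folklore] -/
theorem encF_injective : Function.Injective (encF M) := fun u v h => by
  rw [← decF_encF M u, h, decF_encF]

/-- Coordinates of a sum. [folklore] -/
theorem encF_add (u v : GF2 M) (l : Fin (M + 1)) : encF M (u + v) l = xor (encF M u l) (encF M v l) := by
  simp [encF, zBit_add]

/-- **Coordinates of a `GF(2)`-linear image are a matrix product of the coordinates.** [folklore] -/
theorem encF_linearMap (φ : GF2 M →ₗ[ZMod 2] GF2 M) (u : GF2 M) (j : Fin (M + 1)) :
    encF M (φ u) j = zBit (∑ i, (GF2.basis M).repr (φ (GF2.basis M i)) j * bitZ (encF M u i)) := by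
  unfold encF
  simp only [bitZ_zBit]
  congr 1
  conv_lhs => rw [← (GF2.basis M).sum_repr u, map_sum, map_sum]
  simp only [map_smul, Finsupp.coe_finsetSum, Finsupp.coe_smul, Finset.sum_apply, Pi.smul_apply, smul_eq_mul]
  exact Finset.sum_congr rfl fun i _ => mul_comm _ _

end GF2

end Literature.Computability.Complexity

end
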